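import Literature.AnabelianGeometry.EtaleTheta.Discharge.Sec2ModelCor219
import Literature.AnabelianGeometry.EtaleTheta.Discharge.Sec2Prop214iiOfSetting
import Literature.AnabelianGeometry.EtaleTheta.Discharge.Sec2DtpYThetaAbelianCorollaries
import Literature.AnabelianGeometry.EtaleTheta.CyclotomeTowerAllLevels
import Literature.AnabelianGeometry.EtaleTheta.ThetaRigidityLevels
import HarnessLib

/-!
# [EtTh] Cor. 2.18 (iv) (surjectivity) and Prop. 2.14 / Cor. 2.18 (ii) for the §1 MODEL at EVERY
# level `M ∈ ℕ≥1`, from the FACT-policy inputs (proof-only)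

Mochizuki, *The Étale Theta Function …* [EtTh], Publ. RIMS **45** (2009), §2, Cor. 2.18 (iv)
pp. 61–63, Cor. 2.19 (ii), (iii) pp. 64–66 (locators `p.N` = PDF pages of the PRIMS text; bib key
`MochizukiEtTh2009`). PROOF-ONLY (no `def`, no new named fact; seat abc-iut-L2-t10, gen 3; LONG-CHAINS
lane LC-L2-1 → [IUTchII] Prop. 1.5).

CONTEXT. The [IUTchII] Prop. 1.5 (i)/(ii) model discharges
(`Literature.IUT.HodgeArakelov.EtaleLevels.prop15_i'_of_cyclotomeTower_of_rigid`,
`….transitionsAreIsos_modelSystem`) are indexed by ALL `M ∈ ℕ≥1` through abc-iut-w4-d024's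
identifications `τ.modAll M` (`CyclotomeTowerAllLevels.lean`) and take, BY NAME, at every such level, the
[EtTh] Cor. 2.18 (iv) surjectivity (`RigidData.Cor218_iv_surjective`, FACT-policy) and Prop. 2.14 (i)
(`RigidData.Prop214_i`). The lane-C2 discharges of layer L2 prove these for the model — but so far only
at the levels `M ∈ E` of the CHAIN carrying the `CyclotomeTower` (`rigidData_cor218_iv_surjective`,
`Sec2Cor218ivOfSetting.lean`, with its constant-multiple-rigidity binder `hcoll` supplied at chain
levels by abc-iut-L2-d1's `hcoll_of_cor219_iii`).

THIS FILE closes the gap between "every `M ∈ E`" and "every `M ∈ ℕ≥1`" (the printed "`M_{N'}`, the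
mod `N'` mono-theta environment induced by `M`", Def. 2.13 (ii) p. 48; "The surjectivity of this map
follows by applying the “functorial group-theoretic algorithm” of assertion (ii), in light of the final
portion of assertion (iii) …", Cor. 2.18 (iv) p. 62): for EVERY `M ∈ ℕ≥1`,
* `hcoll_modAll_of_cor219_iii` — the binder `hcoll` of abc-iut-L2-t10's `RigidData.cor218_iv_surjective_of`
  at level `τ.modAll M`, from abc-iut-L2-t2's NAMED FACT `ThetaEnvTower.Cor219_iii` (Cor. 2.19 (iii),
  tower form) for the chain tower + Cor. 2.18 (i) at the chain levels: run abc-iut-L2-d1's chain-level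
  argument at the chosen level `e(M) ∈ E` above `M` and REDUCE along `μ_{e(M)} ↠ μ_M` (the coefficient
  automorphism descends because in the cyclic group `μ_{e(M)}` the kernel of the power map is fully
  invariant, `MuN.exists_mulEquiv_red_comp`; the cocycles descend by abc-iut-w4-d024's
  `thetaCocycles_red_surj_all` / `thetaCocycles_red_mem_all`);
* `rigidData_cor218_ii_modAll`, `rigidData_prop214_ii_modAll` — Cor. 2.18 (ii) / Prop. 2.14 (ii) at
  `τ.modAll M` (the `2`-torsion hypothesis `H2` dies at the lifted chain level; NO origin hypothesis);
* `rigidData_cor218_iv_surjective_modAll` — **Cor. 2.18 (iv) surjectivity at EVERY `M ∈ ℕ≥1`** modulo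
  {Cor. 2.18 (i) at the chain levels, `ThetaEnvTower.Cor219_iii`, Prop. 1.5 (ii), (iii)} — exactly the
  inputs of abc-iut-L2-d1's `cor219_ii_model_of_facts`; `ThetaEnvData`-currency forms
  `thetaEnvData_cor218_iv_surjective_modAll`, `thetaEnvData_cor218_iv_fibre_of_origin` for the L6 consumers.

HONEST FRAMING: kernel-checked reductions to named facts; the hypotheses are not asserted; [EtTh] is
refereed; no side is taken on [IUTchIII] Cor. 3.12; typed ≠ discharged elsewhere.
-/

noncomputable section

namespace Literature.AnabelianGeometry.EtaleTheta

open Literature.AnabelianGeometry.SemiGraphs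

variable (p : ℕ) [Fact p.Prime]

/-! ### Descent of automorphisms of `μ_{M'}` along the power map `μ_{M'} ↠ μ_M` -/

/-- The kernel of `μ_{M'} ↠ μ_M`, `ζ ↦ ζ^{M'/M}`, is the set of `ζ` with `ζ^{M'/M} = 1` (coordinates).
[cite: MochizukiEtTh2009, Def 2.13 (ii) p.48] -/
theorem MuN.red_eq_one_iff_pow (M M' : ℕ+) (h : (M : ℕ) ∣ M') (ζ : MuN p M') :
    MuN.red p M M' h ζ = 1 ↔ ζ ^ ((M' : ℕ) / M) = 1 := by
  rw [Subtype.ext_iff, Subtype.ext_iff, MuN.coe_red, SubmonoidClass.coe_pow]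
  rfl

/-- In the cyclic group `μ_{M'}` the kernel of the power map `μ_{M'} ↠ μ_M` is FULLY INVARIANT: every
endomorphism maps it into itself (`φ(ζ)^{M'/M} = φ(ζ^{M'/M}) = 1`).
[cite: MochizukiEtTh2009, Def 2.13 (ii) p.48] -/
theorem MuN.red_map_eq_one (M M' : ℕ+) (h : (M : ℕ) ∣ M') (φ : MuN p M' →* MuN p M')
    (ζ : MuN p M') (hζ : MuN.red p M M' h ζ = 1) : MuN.red p M M' h (φ ζ) = 1 := by
  rw [MuN.red_eq_one_iff_pow] at hζ ⊢
  rw [← map_pow, hζ, map_one]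

/-- An automorphism of `μ_{M'}` stabilises the kernel of `μ_{M'} ↠ μ_M`.
[cite: MochizukiEtTh2009, Def 2.13 (ii) p.48] -/
theorem MuN.map_ker_red_eq (M M' : ℕ+) (h : (M : ℕ) ∣ M') (ψ : MuN p M' ≃* MuN p M') :
    (MuN.red p M M' h).ker.map ψ.toMonoidHom = (MuN.red p M M' h).ker := by
  refine le_antisymm ?_ ?_
  · rintro _ ⟨ζ, hζ, rfl⟩
    exact MuN.red_map_eq_one p M M' h ψ.toMonoidHom ζ hζ
  · intro ζ hζ
    refine ⟨ψ.symm ζ, MuN.red_map_eq_one p M M' h ψ.symm.toMonoidHom ζ hζ, ?_⟩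
    simp

/-- **Descent of coefficient automorphisms along `μ_{M'} ↠ μ_M`**: every automorphism `ψ` of `μ_{M'}`
induces an automorphism `ψ'` of `μ_M` with `ψ' ∘ red = red ∘ ψ` (the automorphisms "`γ̄_M`" of the
various levels of a mono-theta environment are compatible with "`M_{N'}` … induced by `M`", Def. 2.13 (ii)).
[cite: MochizukiEtTh2009, Def 2.13 (ii) p.48] -/
theorem MuN.exists_mulEquiv_red_comp (M M' : ℕ+) (h : (M : ℕ) ∣ M') (ψ : MuN p M' ≃* MuN p M') :
    ∃ ψ' : MuN p M ≃* MuN p M, ∀ x, ψ' (MuN.red p M M' h x) = MuN.red p M M' h (ψ x) := by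
  set r := MuN.red p M M' h with hr
  have hK := MuN.map_ker_red_eq p M M' h ψ
  let e₁ : MuN p M' ⧸ r.ker ≃* MuN p M' ⧸ r.ker := QuotientGroup.congr r.ker r.ker ψ hK
  let e₂ : MuN p M' ⧸ r.ker ≃* MuN p M :=
    QuotientGroup.quotientKerEquivOfSurjective r (MuN.red_surjective p M M' h)
  have he₂ : ∀ x, e₂ (QuotientGroup.mk x) = r x := fun x => rfl
  refine ⟨e₂.symm.trans (e₁.trans e₂), fun x => ?_⟩
  have hx : e₂.symm (r x) = QuotientGroup.mk x := by
    rw [MulEquiv.symm_apply_eq]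
    exact (he₂ x).symm
  rw [MulEquiv.trans_apply, MulEquiv.trans_apply, hx]
  change e₂ (QuotientGroup.congr r.ker r.ker ψ hK (QuotientGroup.mk x)) = r (ψ x)
  rw [QuotientGroup.congr_mk]
  exact he₂ (ψ x)

/-- Reducing a 1-cocycle for the mod-`M'` cyclotomic character along `μ_{M'} ↠ μ_M` gives a 1-cocycle for
the mod-`M` character (the power maps are Galois-equivariant, `MuN.red_gal`).
[cite: MochizukiEtTh2009, Def 2.13 (ii) p.48] -/
theorem MuN.isEnvCocycle_red_comp {P : Type*} [Group P] (D : ThetaSetting p) (aug : P →* D.GK)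
    (M M' : ℕ+) (h : (M : ℕ) ∣ M') {δ : P → MuN p M'}
    (hδ : CycEnvelope.IsEnvCocycle aug ((galMuN p M').comp D.GK.subtype) δ) :
    CycEnvelope.IsEnvCocycle aug ((galMuN p M).comp D.GK.subtype) (MuN.red p M M' h ∘ δ) := by
  intro g g'
  simp only [Function.comp_apply, hδ g g', map_mul, MonoidHom.coe_comp, Subgroup.coe_subtype,
    MuN.red_gal]

namespace ThetaSetting

namespace EtaleThetaData.DoubleUnderline

variable {p} {D : ThetaSetting p} {E : D.EtaleThetaData} {l : ℕ}
  (C : E.DoubleUnderline l) {Es : Set ℕ+} (τ : D.CyclotomeTower l Es)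

/-! ### Cor. 2.18 (i), (ii) and Prop. 2.14 (ii) at the levels `τ.modAll M`, `M ∈ ℕ≥1` -/

/-- Cor. 2.18 (i) for abc-iut-L2-t8's instantiated rigidity data does not involve the cyclotome
identification: it TRANSFERS verbatim between any two levels (the subquotients `Π^tp_Y̲̲`, `Π^tp_Ÿ̲̲`,
`Δ`, `Ker(Π^tp_X̲̲ ↠ (Π^tp_X)^Θ)`, `l·Δ_Θ` and the labelled cusps are level-free data).
[cite: MochizukiEtTh2009, Cor 2.18 (i) p.60] -/
theorem rigidData_cor218_i_of_level {N N' : ℕ+} (μ : D.CyclotomeMod l N) (μ' : D.CyclotomeMod l N')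
    (hC : D.Compat) (hS : D.Sec2Hyps) (h15 : Prop15iii E hC) (L : C.CuspLabels)
    (h : (C.rigidData μ hC hS h15 L).Cor218_i) : (C.rigidData μ' hC hS h15 L).Cor218_i :=
  fun γ => h γ

/-- The `2`-torsion of `l·Δ_Θ` dies in `μ_M` at EVERY level `M ∈ ℕ≥1` of the all-level identifications
`τ.modAll` (it dies at the chosen chain level `e(M)` above `M`, `CyclotomeTower.red_eq_one_of_sq_eq_one`,
and `modAll M` factors through it) — abc-iut-L2-t10's binder `H2`, no origin hypothesis.
[cite: MochizukiEtTh2009, Cor 2.19 (ii) p.64] -/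
theorem modAll_red_eq_one_of_sq_eq_one (M : ℕ+) (t : D.lDeltaTheta l) (ht : t ^ 2 = 1) :
    (τ.modAll M).red t = 1 := by
  rw [τ.modAll_red M, CyclotomeTower.redVia_apply, τ.red_eq_one_of_sq_eq_one (τ.lift M) t ht, map_one]

/-- **[EtTh] Prop. 2.14 (ii) for the §1 model at EVERY level `M ∈ ℕ≥1`** (identification `τ.modAll M`),
conditional only on Prop. 1.5 (ii), (iii) as named facts. [cite: MochizukiEtTh2009, Prop 2.14 (ii) p.49] -/
theorem rigidData_prop214_ii_modAll (M : ℕ+) (hC : D.Compat) (hS : D.Sec2Hyps) (h15 : Prop15iii E hC)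
    (h15ii : Prop15ii E.toKummerData hC) (L : C.CuspLabels) :
    (C.rigidData (τ.modAll M) hC hS h15 L).Prop214_ii :=
  C.rigidData_prop214_ii_of_H2 (τ.modAll M) hC hS h15 h15ii L (modAll_red_eq_one_of_sq_eq_one τ M)

/-- **[EtTh] Cor. 2.18 (ii) for the §1 model at EVERY level `M ∈ ℕ≥1`** (identification `τ.modAll M`),
conditional only on Prop. 1.5 (ii), (iii) as named facts. [cite: MochizukiEtTh2009, Cor 2.18 (ii) p.60] -/
theorem rigidData_cor218_ii_modAll (M : ℕ+) (hC : D.Compat) (hS : D.Sec2Hyps) (h15 : Prop15iii E hC)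
    (h15ii : Prop15ii E.toKummerData hC) (L : C.CuspLabels) :
    (C.rigidData (τ.modAll M) hC hS h15 L).Cor218_ii :=
  C.rigidData_cor218_ii_of_H2 (τ.modAll M) hC hS h15 h15ii L (modAll_red_eq_one_of_sq_eq_one τ M)

/-! ### Constant multiple rigidity (`hcoll`) at the levels `τ.modAll M`, from Cor. 2.19 (iii) -/

/-- **The constant-multiple-rigidity input `hcoll` of Cor. 2.18 (iv) at EVERY level `M ∈ ℕ≥1`, FROM THE
NAMED FACT `ThetaEnvTower.Cor219_iii`** for the chain tower `C.thetaEnvTower τ hC hS` (+ Cor. 2.18 (i) at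
the chain levels): for every automorphism `γ` of `Π^tp_X̲̲` preserving `Π^tp_Y̲̲` there are `ψ ∈ Aut(μ_M)`
and, for each mod-`M` theta cocycle `η` (identification `τ.modAll M`), a mod-`M` theta cocycle `η''`
and a continuous `G_K`-inflated Kummer cocycle `c` with `ψ(η(d)) = η''(γ d) · c(aug(γ d))`. Obtained
from abc-iut-L2-d1's chain-level argument at the level `e(M) ∈ E` above `M` (Cor. 2.19 (iii) for `γ⁻¹`
with the coefficient automorphisms `γ̄` of Cor. 2.18 (i)) by REDUCTION along `μ_{e(M)} ↠ μ_M`: `ψ`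
descends (`MuN.exists_mulEquiv_red_comp`), the cocycles descend (`thetaCocycles_red_surj_all`,
`thetaCocycles_red_mem_all`), the Kummer cocycle descends (`MuN.isEnvCocycle_red_comp`). This is
literally the binder `hcoll` of `RigidData.cor218_iv_surjective_of` (`Sec2LiftingSurjProofs.lean`) for
`R := C.rigidData (τ.modAll M) hC hS h15 L`. [cite: MochizukiEtTh2009, Cor 2.18 (iv) p.61] -/
theorem hcoll_modAll_of_cor219_iii (hC : D.Compat) (hS : D.Sec2Hyps) (h15 : Prop15iii E hC)
    (L : C.CuspLabels) (h218i : ∀ e : Es, (C.rigidData (τ.mod e) hC hS h15 L).Cor218_i)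
    (h219iii : (C.thetaEnvTower τ hC hS).Cor219_iii) (M : ℕ+)
    (γ : (C.rigidData (τ.modAll M) hC hS h15 L).PiX ≃ₜ* (C.rigidData (τ.modAll M) hC hS h15 L).PiX)
    (_hγ : (C.rigidData (τ.modAll M) hC hS h15 L).PiY.map γ.toMulEquiv.toMonoidHom =
      (C.rigidData (τ.modAll M) hC hS h15 L).PiY) :
    ∃ ψ : (C.rigidData (τ.modAll M) hC hS h15 L).mu ≃* (C.rigidData (τ.modAll M) hC hS h15 L).mu,
      ∀ (η : (C.rigidData (τ.modAll M) hC hS h15 L).PiYdd → (C.rigidData (τ.modAll M) hC hS h15 L).mu),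
        η ∈ (C.rigidData (τ.modAll M) hC hS h15 L).thetaCocycles →
        ∃ (η'' : (C.rigidData (τ.modAll M) hC hS h15 L).PiYdd →
            (C.rigidData (τ.modAll M) hC hS h15 L).mu)
          (_ : η'' ∈ (C.rigidData (τ.modAll M) hC hS h15 L).thetaCocycles)
          (c : (C.rigidData (τ.modAll M) hC hS h15 L).G → (C.rigidData (τ.modAll M) hC hS h15 L).mu)
          (hc : CycEnvelope.IsEnvCocycle (C.rigidData (τ.modAll M) hC hS h15 L).augY
            (C.rigidData (τ.modAll M) hC hS h15 L).chi (c ∘ (C.rigidData (τ.modAll M) hC hS h15 L).augY))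
          (_ : CycEnvelope.shift hc ∈ contMulAut (C.rigidData (τ.modAll M) hC hS h15 L).env),
          ∀ d d' : (C.rigidData (τ.modAll M) hC hS h15 L).PiYdd,
            γ (d : (C.rigidData (τ.modAll M) hC hS h15 L).PiX) = d' →
            ψ (η d) = η'' d' * c ((C.rigidData (τ.modAll M) hC hS h15 L).augY
              ((C.rigidData (τ.modAll M) hC hS h15 L).inclYdd d')) := by
  -- the chosen chain level `e = e(M) ∈ E` above `M`
  have hdiv : (M : ℕ) ∣ ((τ.lift M : ℕ+) : ℕ) := τ.dvd_lift M
  -- preservation of `Π^tp_Ÿ̲̲` by `γ⁻¹` (Cor 2.18 (i), level-free)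
  obtain ⟨-, hdd', -, -, -, -⟩ := h218i (τ.lift M) γ.symm
  -- coefficient automorphisms of `γ⁻¹` at all chain levels, and Cor 2.19 (iii) for `γ⁻¹`
  obtain ⟨γμ, hγμ⟩ := C.exists_coeffAut_family τ hC hS h15 L h218i γ.symm
  obtain ⟨c, hcoc, hlc, -, himg⟩ := h219iii γ.symm hdd' γμ hγμ
  -- descend `ψ_e := (γ̄_e)⁻¹` to `μ_M`
  obtain ⟨ψ, hψ⟩ := MuN.exists_mulEquiv_red_comp p M (τ.lift M) hdiv (γμ (τ.lift M)).symm
  refine ⟨ψ, fun η hη => ?_⟩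
  -- `η` is the reduction of a mod-`e` theta cocycle `η'`
  have hη0 : η ∈ C.thetaCocycles hC (τ.modAll M) := hη
  obtain ⟨η', hη', hred⟩ := C.thetaCocycles_red_surj_all τ hC hdiv hη0
  rw [C.thetaCocycles_modAll_level τ hC (τ.lift M)] at hη'
  -- Cor 2.19 (iii) at level `e` applied to `η'`
  have hmem : (C.thetaEnvTower τ hC hS).pullbackCocycle (τ.lift M) γ.symm hdd' (γμ (τ.lift M)) η' ∈
      (fun η₁ => η₁ * (c (τ.lift M) ∘ (C.thetaEnvTower τ hC hS).aug ∘
        (C.thetaEnvTower τ hC hS).PiYdd.subtype)) '' (C.thetaEnvTower τ hC hS).thetaCocycles (τ.lift M) := by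
    rw [← himg (τ.lift M)]
    exact ⟨η', hη', rfl⟩
  obtain ⟨η₁, hη₁, heq⟩ := hmem
  -- the reduced cocycle `red ∘ η₁` is a mod-`M` theta cocycle
  have hη₁' : MuN.red p M (τ.lift M) hdiv ∘ η₁ ∈ C.thetaCocycles hC (τ.modAll M) :=
    C.thetaCocycles_red_mem_all τ hC hdiv
      (by rw [C.thetaCocycles_modAll_level τ hC (τ.lift M)]; exact hη₁)
  -- the reduced Kummer cocycle `red ∘ c_e`
  have hcocM : CycEnvelope.IsEnvCocycle (C.rigidData (τ.modAll M) hC hS h15 L).augY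
      (C.rigidData (τ.modAll M) hC hS h15 L).chi
      ((MuN.red p M (τ.lift M) hdiv ∘ c (τ.lift M)) ∘ (C.rigidData (τ.modAll M) hC hS h15 L).augY) :=
    MuN.isEnvCocycle_red_comp p D _ M (τ.lift M) hdiv ((hcoc (τ.lift M)).comp _)
  have hcont : Continuous (c (τ.lift M) ∘ (C.rigidData (τ.modAll M) hC hS h15 L).augY) :=
    (hlc (τ.lift M)).continuous.comp continuous_subtype_val
  have hcontM : Continuous
      ((MuN.red p M (τ.lift M) hdiv ∘ c (τ.lift M)) ∘ (C.rigidData (τ.modAll M) hC hS h15 L).augY) :=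
    (continuous_of_discreteTopology (f := ⇑(MuN.red p M (τ.lift M) hdiv))).comp hcont
  refine ⟨MuN.red p M (τ.lift M) hdiv ∘ η₁, hη₁', MuN.red p M (τ.lift M) hdiv ∘ c (τ.lift M), hcocM,
    (C.rigidData (τ.modAll M) hC hS h15 L).shift_mem_contMulAut_of_continuous hcocM hcontM,
    fun d d' hdd => ?_⟩
  -- the chain-level equation at `d'`, reduced to level `M`
  have h1 := congrFun heq d'
  simp only [Pi.mul_apply, Function.comp_apply, ThetaEnvTower.pullbackCocycle] at h1
  have hmemd : γ.symm (d' : (C.rigidData (τ.modAll M) hC hS h15 L).PiX) ∈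
      (C.rigidData (τ.modAll M) hC hS h15 L).PiYdd := by
    rw [← hdd, ContinuousMulEquiv.symm_apply_apply]; exact d.2
  have hd : d = ⟨γ.symm (d' : (C.rigidData (τ.modAll M) hC hS h15 L).PiX), hmemd⟩ :=
    Subtype.ext (by
      rw [← γ.symm_apply_apply (d : (C.rigidData (τ.modAll M) hC hS h15 L).PiX), hdd])
  have hηd : η d = MuN.red p M (τ.lift M) hdiv (η' d) := by
    rw [← hred]; rfl
  have h2 := congrArg (MuN.red p M (τ.lift M) hdiv) h1
  rw [map_mul] at h2
  rw [hηd, hψ, hd]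
  exact h2.symm

/-! ### Cor. 2.18 (iv) at the levels `τ.modAll M`, `M ∈ ℕ≥1` -/

/-- **[EtTh] Cor. 2.18 (iv), surjectivity, for the §1 model at EVERY level `M ∈ ℕ≥1`** (identification
`τ.modAll M`): every automorphism of `Π^tp_X̲̲` preserving `Π^tp_Y̲̲` lifts to an automorphism of the model
mono-theta environment `𝕄_M` — modulo Cor. 2.18 (i) at the chain levels (FACT-policy anabelian input),
the NAMED FACT `ThetaEnvTower.Cor219_iii` (constant multiple rigidity, tower form) and Prop. 1.5 (ii),
(iii) (named facts of §1): the inputs of abc-iut-L2-d1's `cor219_ii_model_of_facts`, now at all of `ℕ≥1`.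
[cite: MochizukiEtTh2009, Cor 2.18 (iv) p.61] -/
theorem rigidData_cor218_iv_surjective_modAll (M : ℕ+) (hC : D.Compat) (hS : D.Sec2Hyps)
    (h15 : Prop15iii E hC) (h15ii : Prop15ii E.toKummerData hC) (L : C.CuspLabels)
    (h218i : ∀ e : Es, (C.rigidData (τ.mod e) hC hS h15 L).Cor218_i)
    (h219iii : (C.thetaEnvTower τ hC hS).Cor219_iii) :
    (C.rigidData (τ.modAll M) hC hS h15 L).Cor218_iv_surjective :=
  RigidData.cor218_iv_surjective_of_cor218_i_ii _
    (C.rigidData_cor218_i_of_level (τ.mod (τ.lift M)) (τ.modAll M) hC hS h15 L (h218i (τ.lift M)))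
    (C.rigidData_cor218_ii_modAll τ M hC hS h15 h15ii L)
    (C.hcoll_modAll_of_cor219_iii τ hC hS h15 L h218i h219iii M)

/-- The same in `ThetaEnvData` currency (`Cor218_iv_surjective` of `C.thetaEnvData (τ.modAll M) hC hS`,
the hypothesis `hsurj`/`hsurj M` of the [IUTchII] Prop. 1.5 (i)/(ii) model discharges of layer L6).
[cite: MochizukiEtTh2009, Cor 2.18 (iv) p.61] -/
theorem thetaEnvData_cor218_iv_surjective_modAll (M : ℕ+) (hC : D.Compat) (hS : D.Sec2Hyps)
    (h15 : Prop15iii E hC) (h15ii : Prop15ii E.toKummerData hC) (L : C.CuspLabels)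
    (h218i : ∀ e : Es, (C.rigidData (τ.mod e) hC hS h15 L).Cor218_i)
    (h219iii : (C.thetaEnvTower τ hC hS).Cor219_iii) :
    (C.thetaEnvData (τ.modAll M) hC hS).Cor218_iv_surjective :=
  (RigidData.cor218_iv_surjective_iff _).1
    (C.rigidData_cor218_iv_surjective_modAll τ M hC hS h15 h15ii L h218i h219iii)

/-- **[EtTh] Cor. 2.18 (iv), fibre clause, in `ThetaEnvData` currency at ANY level** (identification `μ`;
in particular `μ := τ.modAll M`): abc-iut-L2-t8's `rigidData_cor218_iv_fibre_of_origin` (⟸ Prop. 2.14 (i)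
for the model ⟸ `IsEtThOrigin`, `hYcl`) transported along `RigidData.cor218_iv_fibre_iff` — the
hypothesis `hfibre M` of `EtaleLevels.prop15_i'_of_cyclotomeTower`. [cite: MochizukiEtTh2009, Cor 2.18 (iv) p.61] -/
theorem thetaEnvData_cor218_iv_fibre_of_origin {N : ℕ+} (μ : D.CyclotomeMod l N) (hC : D.Compat)
    (hS : D.Sec2Hyps) (h15 : Prop15iii E hC) (L : C.CuspLabels) (hO : D.IsEtThOrigin)
    (hYcl : (D.DtpY.map D.toHat.toMonoidHom).topologicalClosure ≤
      D.DtpY.map D.toHat.toMonoidHom ⊔ (⁅⁅D.DeltaHat, D.DeltaHat⁆, D.DeltaHat⁆).topologicalClosure) :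
    (C.thetaEnvData μ hC hS).Cor218_iv_fibre :=
  (RigidData.cor218_iv_fibre_iff _).1 (C.rigidData_cor218_iv_fibre_of_origin μ hC hS h15 L hO hYcl)

/-- **Summary at EVERY level `M ∈ ℕ≥1`: the two [EtTh] Cor. 2.18 (iv) clauses AND Prop. 2.14 (i) for the
§1 model**, modulo the fact set of abc-iut-L2-d1's `cor219_ii_model_of_facts` {Cor. 2.18 (i) at the chain
levels, `ThetaEnvTower.Cor219_iii`, Prop. 1.5 (ii), (iii), `IsEtThOrigin`, `hYcl`} — the three BY-NAME
binders `hlift`/`h214i`/`hfibre` of the [IUTchII] Prop. 1.5 model discharges, supplied.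
[cite: MochizukiEtTh2009, Cor 2.18 (iv) p.61] -/
theorem rigidData_cor218_iv_and_prop214_i_modAll (M : ℕ+) (hC : D.Compat) (hS : D.Sec2Hyps)
    (h15 : Prop15iii E hC) (h15ii : Prop15ii E.toKummerData hC) (L : C.CuspLabels)
    (h218i : ∀ e : Es, (C.rigidData (τ.mod e) hC hS h15 L).Cor218_i)
    (h219iii : (C.thetaEnvTower τ hC hS).Cor219_iii) (hO : D.IsEtThOrigin)
    (hYcl : (D.DtpY.map D.toHat.toMonoidHom).topologicalClosure ≤
      D.DtpY.map D.toHat.toMonoidHom ⊔ (⁅⁅D.DeltaHat, D.DeltaHat⁆, D.DeltaHat⁆).topologicalClosure) :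
    (C.rigidData (τ.modAll M) hC hS h15 L).Cor218_iv_surjective ∧
      (C.rigidData (τ.modAll M) hC hS h15 L).Cor218_iv_fibre ∧
      (C.rigidData (τ.modAll M) hC hS h15 L).Prop214_i :=
  ⟨C.rigidData_cor218_iv_surjective_modAll τ M hC hS h15 h15ii L h218i h219iii,
    C.rigidData_cor218_iv_fibre_of_origin (τ.modAll M) hC hS h15 L hO hYcl,
    C.rigidData_prop214_i_of_origin (τ.modAll M) hC hS h15 L hO hYcl⟩

end EtaleThetaData.DoubleUnderline

end ThetaSetting

end Literature.AnabelianGeometry.EtaleTheta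

end
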